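import Summits.CriticalPhenomena.SAWScalingLimit.Theses.SAWDefectDecoherence
import HarnessLib.Audit

/-!
# Line `sector-slaving` — checked skeleton for the crux `SAWDefectDecoherence.DefectDecoherence`
(stmt-CriticalPhenomena-8549; planner-cruxplan-stmt-CriticalPhenomena-8549-sector-slaving-0, round 1)

Crux (FIXED, by name): `∃ C, θ > 3/4` such that for every simply connected hexagonal domain `Λ`,
boundary root `a = s(u,w)` (`u ∉ Λ ∋ w`), `R`-deep vertex `v` (`R ≥ 1`):
`‖Σ_{t∼v} conj(mid{v,t} − c_v)·F_{x_c,5/8}({v,t})‖ ≤ C R^{−θ} Σ_{t∼v} ‖F_{x_c,0}({v,t})‖`,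
i.e. `‖conjStar Λ a v‖ ≤ C R^{−θ} · starMass Λ a v` (`crux_iff` below, `Iff.rfl`).

IDEA (card `Ideas/sector-slaving.md`, triage r1: pass / fail / pass). Split the `x_c`-weighted walks from
the root by the DART through which they arrive at a vertex and by the LIFTED arrival angle
`Θ = θ_a + W(γ)`; the three ℤ/3-characters of the clean vertex-arrival law at `z`,
`A_ξ(z) = arrivalSum Λ a θ_a ξ z` at `ξ ∈ {U = −3/8, S = 5/8, D = 13/8}`, obey an EXACT nearest-neighbour
system (one-step decomposition + character inversion over the three darts at each neighbour + the `±60°`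
turn).  Its `D`-row (`stub_sectorRowD`) expresses the full via-`t` defect sum `Ā_D(v) = viaSum … (13/8) v`
through the discrete `∂̄`-difference of `U`, the discrete `∂`-difference of `S` (both PURE DIFFERENCES over
the star, since `Σ_t e(t) = Σ_t e(t)² = 0`) and a diagonal term with the small coupling
`2x_c cos(13π/24) = −2x_c sin(π/24) = −0.1413`.  The crux numerator is EXACTLY
`conjStar = tipPhase · (x_c⁻¹ Ā_D + 2 sin(π/24) A_D)` (`stub_tipRegrouping`, DCS's triplet/pair regrouping
run at the conjugate coefficient).  So decoherence of the defect channel is SLAVED to one-step regularity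
of the two free sectors (`stub_unstableStarGradient` — HARDEST, `stub_signalStarGradient`), the decay of the
loop-dressed (dirty) defect sum (`stub_dressedDefectDecay`) and a neighbour mass Harnack inequality with an
explicit threshold (`stub_starMassHarnack`), by a discrete maximum-principle induction on the depth
(`stub_defectSlaving`).  `defectDecoherence_of_parts` composes the seven stub STATEMENTS into the crux statement with
a real proof (triangle inequality + exponent bookkeeping); `DefectDecoherence_of : DefectDecoherence` feeds it
the stubs and concludes the crux BY NAME.

Predicted sizes against the star mass (Coulomb gas / the standing disprover's spectral finding 3 /
KM numerics θ_eff ≈ 1.15 / triage r1-1 Poisson dictionary): `∂̄U`-source `R^{−19/16}` (leading),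
`∂S`-source `R^{−73/48}`, dressed defect `≈ N̄·R^{−19/16}`, diagonal `0.14 ×` defect; all inputs need only
`θ > 3/4`, margins `7/16`, `37/48`, `7/16`.  Exact rows verified by three seats (enumeration to `1e−14`).

Disproof.lean honoured (cycle-1 file of refuter-cdisprove-stmt-CriticalPhenomena-8549-0, evidence on 8549;
not mounted in this jail, used through its evidence notes): `defectDecoherence_false_without_depth` — the
`R`-ball hypothesis is carried by every decay stub (`stub_unstableStarGradient`, `stub_signalStarGradient`,
`stub_dressedDefectDecay`, hence `stub_defectSlaving`), and the induction in `stub_defectSlaving` consumes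
depth step by step (each lattice step inward costs `ℓ = 1/√3` of depth, the contraction `0.14·c/3 < 1`
per step is what turns depth into decay); Dictionary `conj_star_sum_eq` / `defectDecoherence_iff_plainStar`
(crux ⟺ plain spin `−11/8` star sum) is the `σ ↦ σ − 2` alias of `stub_tipRegrouping` (our `13/8` is the
arrival-angle frequency `σ + 1`; per dart `e^{−i(13/8)Θ} = e^{+i(11/8)·(−Θ)}…` — same object, mass-relative
as the Dictionary demands); "signal-relative strengthening predicted false (2/3 < 3/4)" — every stub is
normalised by the star MASS, never by the signal.  No landed Negative lemma exists for this crux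
(`Theorems/DefectDecoherence/Negative/` absent); `ledger negatives`: 0772/8312/8261/5420 unrelated.
-/

set_option linter.unusedVariables false
set_option linter.dupNamespace false

noncomputable section

open scoped BigOperators Topology ComplexConjugate
open Classical

namespace Summit.CriticalPhenomena.SAWScalingLimit.Cruxes.DefectDecoherence.SectorSlaving

open Literature.Probability.LatticeModels Literature.Probability.RandomPlanarGeometry.SAW
open Summit.CriticalPhenomena.SAWScalingLimit.Theses.SAWDefectDecoherence (DefectDecoherence)

/-! ## §0 Vocabulary (over `HexMidEdgeSAW`, `hexParafermionicObservable`, `hexCriticalFugacity`,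
`hexMidpoint`, `hexCenter`, `hexGraph` — all existing tree declarations) -/

/-- Direction `θ_a` of the root dart `u → w` (the first half-step of every walk from `a = s(u,w)`, `u ∉ Λ`). [folklore] -/
def rootAngle (u w : HexVertex) : ℝ := Complex.arg (hexCenter w - hexCenter u)

/-- Unit vector `e(t)` of the dart `t → v` (for adjacent `t, v`: `(c_v − c_t)/ℓ`, `ℓ = 1/√3`). [folklore] -/
def dartUnit (v t : HexVertex) : ℂ :=
  (hexCenter v - hexCenter t) / ((‖hexCenter v - hexCenter t‖ : ℝ) : ℂ)

/-- **Clean twisted arrival sum** `A_ξ(z) = Σ_{s∼z} Σ_{γ : a → s(s,z), last vertex s, z ∉ γ}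
x_c^{ℓ(γ)+1} e^{−iξ(θ_a + W(γ))}`: walks arriving AT the vertex `z` (not yet visited) through one of its
darts, weighted with `z` counted, phase = character `ξ` of the LIFTED arrival direction `Θ = θ_a + W`.
`ξ = 0`: clean arrival mass; `ξ = −3/8, 5/8, 13/8`: the sectors `U, S, D`. [folklore] -/
def arrivalSum (Λ : Finset HexVertex) (a : Sym2 HexVertex) (θa ξ : ℝ) (z : HexVertex) : ℂ :=
  ∑ s ∈ Λ.filter (fun s => hexGraph.Adj z s), ∑ γ : HexMidEdgeSAW Λ a s(s, z),
    if γ.verts.getLast? = some s ∧ z ∉ γ.verts then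
      (hexCriticalFugacity : ℂ) ^ (γ.length + 1) *
        Complex.exp (-Complex.I * (ξ : ℂ) * ((θa + γ.winding : ℝ) : ℂ))
    else 0

/-- **Full via-dart sum** `Ā_ξ(z)`: as `arrivalSum` but WITHOUT the cleanliness condition `z ∉ γ`
(walks ending on a mid-edge of `z` with last vertex a neighbour `s`, pointing into `z`; the ones that
visited `z` earlier are DCS's "dirty" walks = loop-dressed arrivals).  `Ā_ξ − A_ξ = Dirty_ξ`. [folklore] -/
def viaSum (Λ : Finset HexVertex) (a : Sym2 HexVertex) (θa ξ : ℝ) (z : HexVertex) : ℂ :=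
  ∑ s ∈ Λ.filter (fun s => hexGraph.Adj z s), ∑ γ : HexMidEdgeSAW Λ a s(s, z),
    if γ.verts.getLast? = some s then
      (hexCriticalFugacity : ℂ) ^ (γ.length + 1) *
        Complex.exp (-Complex.I * (ξ : ℂ) * ((θa + γ.winding : ℝ) : ℂ))
    else 0

/-- The crux's normaliser, VERBATIM: the star mass `M(v) = Σ_{t∼v} ‖F_{x_c,0}({v,t})‖`. [folklore] -/
def starMass (Λ : Finset HexVertex) (a : Sym2 HexVertex) (v : HexVertex) : ℝ :=
  ∑ t ∈ Λ.filter (fun t => hexGraph.Adj v t),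
    ‖hexParafermionicObservable Λ a hexCriticalFugacity 0 s(v, t)‖

/-- The crux's numerator, VERBATIM: the conjugated star sum
`T(v) = Σ_{t∼v} conj(mid{v,t} − c_v) F_{x_c,5/8}({v,t})`. [folklore] -/
def conjStar (Λ : Finset HexVertex) (a : Sym2 HexVertex) (v : HexVertex) : ℂ :=
  ∑ t ∈ Λ.filter (fun t => hexGraph.Adj v t),
    (starRingEnd ℂ) (hexMidpoint s(v, t) - hexCenter v) *
      hexParafermionicObservable Λ a hexCriticalFugacity (5 / 8) s(v, t)

/-- The unit-free tip phase `κ = −(ℓ/2)·e^{i(5/8)θ_a}`, `ℓ/2 = 1/(2√3) = √3/6`. [folklore] -/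
def tipPhase (u w : HexVertex) : ℂ :=
  ((-(Real.sqrt 3 / 6) : ℝ) : ℂ) * Complex.exp (((5 / 8 * rootAngle u w : ℝ) : ℂ) * Complex.I)

/-- The crux, definitionally (sanity check that the vocabulary is verbatim). [folklore] -/
theorem crux_iff :
    DefectDecoherence ↔
      ∃ C θ : ℝ, 3 / 4 < θ ∧ ∀ (Λ : Finset HexVertex), hexDomainSimplyConnected Λ →
        ∀ (u w : HexVertex), hexGraph.Adj u w → u ∉ Λ → w ∈ Λ →
          ∀ (v : HexVertex) (R : ℝ), 1 ≤ R →
            (∀ y : HexVertex, dist (hexCenter y) (hexCenter v) ≤ R → y ∈ Λ) →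
              ‖conjStar Λ s(u, w) v‖ ≤ C * R ^ (-θ) * starMass Λ s(u, w) v :=
  Iff.rfl

/-! ## §1 The stub statements (the obligations of this line; `theorem stub_x : X := by sorry` in §3) -/

/-- **TipRegrouping** (exact; provable now; size M–L).  At a `1`-deep vertex `v` of any `Λ` with root
dart `u → w`: (i) `T(v) = κ·(x_c⁻¹·Ā_D(v) + 2 sin(π/24)·A_D(v))` — the via-`t` walks at the three
mid-edges of `v` ARE the terms of `Ā_{13/8}(v)` (coefficient `conj(mid − c_v)·e^{−iσW} =
−(ℓ/2)e^{iσθ_a}x_c⁻¹ · x_c^{ℓ+1}e^{−i(13/8)Θ}`, the final dart direction being `e^{iΘ}`,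
`Θ = θ_a + W` by the telescoping `e^{iW}·(first increment) ∝ (last increment)`); the via-`v` walks are
`{clean arrivals at v} × {turn ±60°}`, the turn sum being `2cos(13π/24) = −2 sin(π/24)`
(TipOneStep of card loop-dressed-clean-arrival, verified to 1e−15 by all three triagers);
(ii) the mass identity `M(v) = x_c⁻¹ Ā_0(v) + 2 A_0(v)` (same two bijections at `ξ = 0`).
Leans on: `HexMidEdgeSAW.{verts,length,winding,weight}`, `hexParafermionicObservable_def`,
`Literature.Probability.LatticeModels.winding` additivity (`winding_cons_cons_cons`, `pturn_walk_eq`,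
`hopf_path` family in HexSAWWinding/HexSAWHopfPath), the disprover's Dictionary lemma `exp_winding_mul`
(evidence on 8549: re-prove, 30 lines), `2cos(13π/24) = −2sin(π/24)`, `‖c_w − c_u‖ = 1/√3`. -/
def TipRegrouping : Prop :=
  ∀ (Λ : Finset HexVertex) (u w : HexVertex), hexGraph.Adj u w → u ∉ Λ → w ∈ Λ →
    ∀ v : HexVertex, (∀ y : HexVertex, dist (hexCenter y) (hexCenter v) ≤ 1 → y ∈ Λ) →
      conjStar Λ s(u, w) v =
          tipPhase u w *
            (((hexCriticalFugacity⁻¹ : ℝ) : ℂ) * viaSum Λ s(u, w) (rootAngle u w) (13 / 8) v +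
              ((2 * Real.sin (Real.pi / 24) : ℝ) : ℂ) *
                arrivalSum Λ s(u, w) (rootAngle u w) (13 / 8) v) ∧
        ((starMass Λ s(u, w) v : ℝ) : ℂ) =
          ((hexCriticalFugacity⁻¹ : ℝ) : ℂ) * viaSum Λ s(u, w) (rootAngle u w) 0 v +
            2 * arrivalSum Λ s(u, w) (rootAngle u w) 0 v

/-- **SectorRowD** (exact; provable now; size L) — the `D`-row of the sector system at a `2`-deep
vertex `v` of any `Λ` with root dart `u → w`:
`Ā_D(v) = (1/3)Σ_t ē(t)² U(t) + (2x_c cos(5π/24)/3) Σ_t ē(t) S(t) + (2x_c cos(13π/24)/3) Σ_t D(t)`,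
`e(t) = dartUnit v t`, `U,S,D = A_{−3/8}, A_{5/8}, A_{13/8}` at the three neighbours.  Proof shape:
(1) via-`t` walks at `mid{t,v}` ↔ `{(s', ω') : s' ∼ t, s' ≠ v, ω' a clean arrival at t through the dart
s' → t}` (strip/append the vertex `t`; `s' = v` is excluded by `edges_nodup`, the trivial prefix by
2-depth), windings add the turn `∓π/3`; (2) on a fixed dart all walks have the same direction mod `2π`,
so `B_{ξ+k}(t,s') = d_{s'}^{−k} B_ξ(t,s')` and the three sector sums at `t` invert:
`B_U(t,s') = (1/3)Σ_k d_{s'}^k A_{ξ_k}(t)` (`Σ_{s'} (d_{s'}/d_{s''})^k = 3·[s' = s'']`);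
(3) the two darts `s' ≠ v` have `d_{s'} = e(t)e^{±iπ/3}` and turn `∓π/3`, giving the factor
`e(t)^{k−2}·2cos(ξ_kπ/3)`; `2x_c cos(π/8) = 1`.  (Rows `U`, `S`: `SectorSystem` below, not stubs.)
Verified exactly by three seats (relative residual ≤ 1.8e−13, balls R ≤ 3 and an irregular domain). -/
def SectorRowD : Prop :=
  ∀ (Λ : Finset HexVertex) (u w : HexVertex), hexGraph.Adj u w → u ∉ Λ → w ∈ Λ →
    ∀ v : HexVertex, (∀ y : HexVertex, dist (hexCenter y) (hexCenter v) ≤ 2 → y ∈ Λ) →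
      viaSum Λ s(u, w) (rootAngle u w) (13 / 8) v =
        ∑ t ∈ Λ.filter (fun t => hexGraph.Adj v t),
          ((1 / 3 : ℂ) * (starRingEnd ℂ (dartUnit v t)) ^ 2 *
                arrivalSum Λ s(u, w) (rootAngle u w) (-3 / 8) t +
              ((2 * hexCriticalFugacity * Real.cos (5 * Real.pi / 24) / 3 : ℝ) : ℂ) *
                  starRingEnd ℂ (dartUnit v t) * arrivalSum Λ s(u, w) (rootAngle u w) (5 / 8) t +
            ((2 * hexCriticalFugacity * Real.cos (13 * Real.pi / 24) / 3 : ℝ) : ℂ) *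
              arrivalSum Λ s(u, w) (rootAngle u w) (13 / 8) t)

/-- **StarMassHarnack** (positive measure; the line's ONE positive-mass input, shared in substance with
the other lines' "return-loop / 3-arm" inputs; size L, finiteness part OPEN).  Neighbour star masses are
comparable with an explicit constant below the contraction threshold of the `D`-row:
`Σ_{t∼v} M(t) ≤ c·M(v)` with `c · 2x_c sin(π/24) < 3`, i.e. `c < 21.2` (prediction `c → 3`).
Reduction (exact, M-sized): `Σ_t M(t) ≤ (x_c⁻¹(1+N') + 2)·Σ_t A_0(t)` and `Σ_t A_0(t) ≤ M(v)`
(append the dart `t → v`), where `N' = sup (dirty via-mass)/(clean arrival mass)` at a deep vertex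
`≤ 2x_c · sup_ω N(ω)`, `N(ω)` = `x_c`-mass of self-avoiding return loops at the tip; so the stub follows
from `sup N < 8.5` (predicted `N̄ ≈ 0.04–0.08`).  Why it might fail / what is open: uniform finiteness of
the critical rooted loop mass ⟸ `p_n = O(μ^n n^{−2−ε})` for polygons (predicted `n^{−5/2}`; Hammond's
`n^{−3/2+o(1)}` is one power short) — TipReturnLoops (card's barrier note). Sources: MadrasSlade1993,
arXiv:1504.05286, DuminilCopinSmirnov2012. -/
def StarMassHarnack : Prop :=
  ∃ c : ℝ, c * (2 * hexCriticalFugacity * Real.sin (Real.pi / 24)) < 3 ∧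
    ∀ (Λ : Finset HexVertex), hexDomainSimplyConnected Λ →
      ∀ (u w : HexVertex), hexGraph.Adj u w → u ∉ Λ → w ∈ Λ →
        ∀ v : HexVertex, (∀ y : HexVertex, dist (hexCenter y) (hexCenter v) ≤ 2 → y ∈ Λ) →
          ∑ t ∈ Λ.filter (fun t => hexGraph.Adj v t), starMass Λ s(u, w) t ≤
            c * starMass Λ s(u, w) v

/-- **UnstableStarGradient** (HARDEST stub; the residual bet of the line; open).  The discrete
`∂̄`-difference of the UNSTABLE sector over the star of an `R`-deep vertex decays against the star mass:
`‖Σ_{t∼v} ē(t)² U(t)‖ ≤ C R^{−θ} M(v)`, `θ > 3/4` (a pure difference: `Σ_t ē(t)² = 0`).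
This is exactly the `U`-source of the `D`-row; prediction `ℓ·|∇u| ≍ R^{−1−3/16} = R^{−19/16}` relative
to mass (the LEADING term of the defect; margin `7/16`).  Equivalent form (exact ℤ/3 covariance
`A_ξ[ρΛ,ρa](ρt) = c·A_ξ[Λ,a](t)`, `|c| = 1`, `ρ` = rotation by `120°` about `c_v`, a lattice symmetry
fixing the clean ball `B(v,R)`): the three values `U(t)`, `t ∼ v`, nearly agree iff `U` at ONE neighbour
`t₀` is unchanged, up to the covariance phase, when `(Λ, a)` is rigidly rotated about `v` OUTSIDE the
shared clean ball — insensitivity of the `U`-weighted arrival amplitude at `t₀` to the far field, to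
accuracy `R^{−3/4}M ≈ R^{−9/16}|U|`.  Engines: (a) target-insensitivity in RATIO form of the `U`-weighted
last-entrance kernel inside the clean ball (from an entrance at distance `r` it cannot tell `t₀` from
`ρt₀` beyond the deterministic phase, error summable over `r ≤ R`) + a dirt-depth tail — the one-scale
machinery of lines tip-martingale / endpoint-umlaufsatz run in the most coherent channel, where (the bet)
ratio-type regularity is available because `U` is the channel carrying a macroscopic, slowly decaying
amplitude, so only `9/16` of RELATIVE precision is needed; (b) the exact `U`-row
`U − avg U = (c_S/3)∂̄S + (c_D/3)e³∂D` (discrete Poisson, `SectorSystem`) + interior estimates for the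
honeycomb Laplacian, which close iff the `S`-sector is discrete-holomorphic to second order
(`|Σ_t e(t)S(t)| ≲ R^{−7/4−}M`, predicted `R^{−2.52}`) — NOT from sup bounds alone (triage r1-2/3: the
order-zero Riesz transform of `S` only gives `R^{−25/48}`).  Why it might fail: persistent lattice-scale
class structure of the `U`-arrival law (the `μ̂_{−1}` amplitude of triage r1-1) decaying slower than
`R^{−9/16}`; honours `_false_without_depth` (depth is the only source of decay).
Sources: arXiv:1007.0575 §4, arXiv:1203.2959 §2–3 (`F̄(v)`), DuplantierSaleur1988, Jacobsen2009 §14.4.6. -/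
def UnstableStarGradient : Prop :=
  ∃ C θ : ℝ, 3 / 4 < θ ∧ ∀ (Λ : Finset HexVertex), hexDomainSimplyConnected Λ →
    ∀ (u w : HexVertex), hexGraph.Adj u w → u ∉ Λ → w ∈ Λ →
      ∀ (v : HexVertex) (R : ℝ), 1 ≤ R →
        (∀ y : HexVertex, dist (hexCenter y) (hexCenter v) ≤ R → y ∈ Λ) →
          ‖∑ t ∈ Λ.filter (fun t => hexGraph.Adj v t),
              (starRingEnd ℂ (dartUnit v t)) ^ 2 * arrivalSum Λ s(u, w) (rootAngle u w) (-3 / 8) t‖ ≤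
            C * R ^ (-θ) * starMass Λ s(u, w) v

/-- **SignalStarGradient** (open; size XL but with the largest margin).  The discrete `∂`-difference of
the SIGNAL sector over the star of an `R`-deep vertex decays against the star mass:
`‖Σ_{t∼v} ē(t) S(t)‖ ≤ C R^{−θ} M(v)`, `θ > 3/4` (pure difference: `Σ_t ē(t) = 0`) — the `S`-source of
the `D`-row.  Prediction `ℓ·|s′| ≍ R^{−1−25/48} = R^{−73/48}` (margin `37/48`): a Lipschitz statement at
relative precision `R^{−11/48}` for the sector that SHOULD converge; NOT the discrete Cauchy–Riemann
combination of `S` (that would be `Σ_t e(t)S(t)`).  Same engines as the `U`-stub (one-scale ℤ/3 mixing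
of the `S`-weighted transfer, needing only `11/48`).  Why it might fail: only through a failure of local
rotation covariance of the signal sector at relative scale `R^{−0.23}` — which would also kill the weak
curl → 0 reading of DCS Conjecture 2 (route kill criterion).  Sources: arXiv:1007.0575, arXiv:1009.6077 §5. -/
def SignalStarGradient : Prop :=
  ∃ C θ : ℝ, 3 / 4 < θ ∧ ∀ (Λ : Finset HexVertex), hexDomainSimplyConnected Λ →
    ∀ (u w : HexVertex), hexGraph.Adj u w → u ∉ Λ → w ∈ Λ →
      ∀ (v : HexVertex) (R : ℝ), 1 ≤ R →
        (∀ y : HexVertex, dist (hexCenter y) (hexCenter v) ≤ R → y ∈ Λ) →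
          ‖∑ t ∈ Λ.filter (fun t => hexGraph.Adj v t),
              starRingEnd ℂ (dartUnit v t) * arrivalSum Λ s(u, w) (rootAngle u w) (5 / 8) t‖ ≤
            C * R ^ (-θ) * starMass Λ s(u, w) v

/-- **DressedDefectDecay** (open; size XL; shares its hard part with the other lines' 3-arm input).
The DIRTY (loop-dressed) via-dart defect sum at an `R`-deep vertex decays against the star mass:
`‖Ā_D(v) − A_D(v)‖ ≤ C R^{−θ} M(v)`, `θ > 3/4`.  Two exact readings: (i) `Ā_D − A_D = √3 · 𝒩_D` with
`𝒩_ξ(v) = Σ_ω x_c^{ℓ(ω)+2} N(ω) e^{−iξΘ(ω)}` the return-loop-dressed clean arrival law (`N(ω)` = `x_c`-mass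
of unordered return loops at the tip; the two orientations shift the lifted angle by `±4π/3`,
`2cos(13π/6) = √3`; at `ξ = −3/8` the same pairing gives `2cos(π/2) = 0` = DCS's pair cancellation, so
`Ā_U = A_U`); (ii) by the SAME one-step bijection as `SectorRowD`, `Ā_D(v) − A_D(v)` is the `D`-row
functional `Σ_k (c_k/3) Σ_t e(t)^{k−2}(·)_{ξ_k}(t)` applied to the through-`v` SUB-POPULATION of the
neighbours' clean sectors (clean arrivals at `t` that visited `v` earlier), so the stub follows from the
`U`/`S` star-gradient bounds for that sub-population (same rotation-about-`v` reformulation as the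
hardest stub, `v` being the centre; mass ≈ `2x_c N̄ ≈ 8%` of `M`) plus its far part.  Proof plan
(triage r1-1 sharpening): split `N = N_{≤r₀} + N_{>r₀}`, `r₀ = R^{1/2}`; loops leaving `B(v, r₀)` are a
3-leg event from the tip (positive-mass tail, predicted exponent `3/2` per scale); small loops are
finitely many local end-patterns whose dressed `13/8`-sums are sector sums in the pattern-slit domains
(boundary version of the `D`-row).  Prediction `≍ N̄ R^{−19/16}·M`.  Why it might fail: a heavy tail of
macroscopic return loops at the tip entering the `13/8` channel coherently (no ℤ/3 cancellation for the
dressing: coefficient `√3`).  It is crux-TYPE on an 8% sub-population — the honest residue of the dirty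
side; the line's content is that the clean 92% is slaved.
Sources: DuminilCopinSmirnov2012 (pairs), arXiv:1504.05286, LawlerSchrammWerner2004SAW (arm exponents). -/
def DressedDefectDecay : Prop :=
  ∃ C θ : ℝ, 3 / 4 < θ ∧ ∀ (Λ : Finset HexVertex), hexDomainSimplyConnected Λ →
    ∀ (u w : HexVertex), hexGraph.Adj u w → u ∉ Λ → w ∈ Λ →
      ∀ (v : HexVertex) (R : ℝ), 1 ≤ R →
        (∀ y : HexVertex, dist (hexCenter y) (hexCenter v) ≤ R → y ∈ Λ) →
          ‖viaSum Λ s(u, w) (rootAngle u w) (13 / 8) v -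
              arrivalSum Λ s(u, w) (rootAngle u w) (13 / 8) v‖ ≤
            C * R ^ (-θ) * starMass Λ s(u, w) v

/-- **CleanDefectDecay** (the DERIVED node, = card loop-dressed-clean-arrival's `CleanArrivalDecoherence`
normalised by the star mass): the clean defect sector decays, `‖A_D(v)‖ ≤ C R^{−θ} M(v)`, `θ > 3/4`.
Not a stub: it is the conclusion of `DefectSlaving`. [folklore] -/
def CleanDefectDecay : Prop :=
  ∃ C θ : ℝ, 3 / 4 < θ ∧ ∀ (Λ : Finset HexVertex), hexDomainSimplyConnected Λ →
    ∀ (u w : HexVertex), hexGraph.Adj u w → u ∉ Λ → w ∈ Λ →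
      ∀ (v : HexVertex) (R : ℝ), 1 ≤ R →
        (∀ y : HexVertex, dist (hexCenter y) (hexCenter v) ≤ R → y ∈ Λ) →
          ‖arrivalSum Λ s(u, w) (rootAngle u w) (13 / 8) v‖ ≤ C * R ^ (-θ) * starMass Λ s(u, w) v

/-- **DefectSlaving** (size M; provable now GIVEN the five statements — elementary real analysis).
The `D`-row + triangle inequality give, at every `2`-deep `v`,
`‖A_D(v)‖ ≤ ‖Ā_D(v) − A_D(v)‖ + (1/3)‖Σē²U‖ + (c_S/3)‖ΣēS‖ + (q/3)Σ_t‖A_D(t)‖`, `q = 2x_c sin(π/24)`.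
With `Φ(R) := sup ‖A_D(v)‖/M(v)` over all (Λ simply connected, root, v R-deep) — `Φ ≤ 1` trivially
(`‖A_D‖ ≤ A_0 ≤ M/2` by the via-`v` injection) — a neighbour of an `R`-deep vertex is `(R − 1/√3)`-deep
and `Σ_t M(t) ≤ c M(v)`, so `Φ(R) ≤ (qc/3)·Φ(R − 1/√3) + C′R^{−θ′}`, `θ′ = min θ_i > 3/4`,
`κ := qc/3 < 1`; iterating `⌊√3 R/2⌋` times, `Φ(R) ≤ C′(R/2)^{−θ′}/(1−κ) + κ^{√3R/2 − 1} ≤ C″R^{−θ′}`;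
`1 ≤ R < 2` is absorbed in the constant.  (This is where depth is CONSUMED: honours `_false_without_depth`.) -/
def DefectSlaving : Prop :=
  SectorRowD → StarMassHarnack → UnstableStarGradient → SignalStarGradient → DressedDefectDecay →
    CleanDefectDecay

/-! ## §2 Engine inputs that are NOT stubs (exact, provable now; file as `--supports` helpers) -/

/-- The full three-row sector system (rows `k' = 0, 1, 2` ↔ `U, S, D`), any `Λ`, root dart `u → w`,
`2`-deep `v`: `Ā_{ξ'}(v) = Σ_k (2x_c cos(ξ_kπ/3)/3) Σ_t e(t)^{k−k'} A_{ξ_k}(t)`, `ξ_k = −3/8 + k`, written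
with `conj e = e⁻¹`.  Row 2 is `SectorRowD`; row 0 is the discrete Poisson equation of the unstable
sector (`2x_c cos(π/8) = 1`: `U` is the conserved current), row 1 the (dirty-renormalised) signal row. [folklore] -/
def SectorSystem : Prop :=
  ∀ (Λ : Finset HexVertex) (u w : HexVertex), hexGraph.Adj u w → u ∉ Λ → w ∈ Λ →
    ∀ v : HexVertex, (∀ y : HexVertex, dist (hexCenter y) (hexCenter v) ≤ 2 → y ∈ Λ) →
      ∀ k' : Fin 3,
        viaSum Λ s(u, w) (rootAngle u w) (-3 / 8 + (k' : ℕ)) v =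
          ∑ k : Fin 3, ∑ t ∈ Λ.filter (fun t => hexGraph.Adj v t),
            ((2 * hexCriticalFugacity * Real.cos ((-3 / 8 + (k : ℕ)) * Real.pi / 3) / 3 : ℝ) : ℂ) *
              (if (k' : ℕ) ≤ (k : ℕ) then dartUnit v t ^ ((k : ℕ) - (k' : ℕ))
                else starRingEnd ℂ (dartUnit v t) ^ ((k' : ℕ) - (k : ℕ))) *
                arrivalSum Λ s(u, w) (rootAngle u w) (-3 / 8 + (k : ℕ)) t

/-- `Dirty_U ≡ 0`: the unstable sector has no loop dressing (`Ā_U = A_U`) at a `1`-deep vertex — the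
two orientations of each return loop shift the lifted arrival angle by `±4π/3` and `2cos(π/2) = 0`
(DCS's pair cancellation; `hexDomainSimplyConnected` not needed, the loop is a simple lattice polygon). [folklore] -/
def UnstableNoDressing : Prop :=
  ∀ (Λ : Finset HexVertex) (u w : HexVertex), hexGraph.Adj u w → u ∉ Λ → w ∈ Λ →
    ∀ v : HexVertex, (∀ y : HexVertex, dist (hexCenter y) (hexCenter v) ≤ 1 → y ∈ Λ) →
      viaSum Λ s(u, w) (rootAngle u w) (-3 / 8) v = arrivalSum Λ s(u, w) (rootAngle u w) (-3 / 8) v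

/-! ## §3 Registered stubs -/

/-- stub 1/7 — exact tip regrouping (provable now, M–L). See `TipRegrouping`. -/
theorem stub_tipRegrouping : TipRegrouping := by
  sorry

/-- stub 2/7 — exact `D`-row of the sector system (provable now, L). See `SectorRowD`. -/
theorem stub_sectorRowD : SectorRowD := by
  sorry

/-- stub 3/7 — neighbour star-mass Harnack with threshold `c·q < 3` (positive mass). See `StarMassHarnack`. -/
theorem stub_starMassHarnack : StarMassHarnack := by
  sorry

/-- stub 4/7 — HARDEST: decay of the `∂̄`-difference of the unstable sector. See `UnstableStarGradient`. -/
theorem stub_unstableStarGradient : UnstableStarGradient := by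
  sorry

/-- stub 5/7 — decay of the `∂`-difference of the signal sector. See `SignalStarGradient`. -/
theorem stub_signalStarGradient : SignalStarGradient := by
  sorry

/-- stub 6/7 — decay of the loop-dressed defect sum. See `DressedDefectDecay`. -/
theorem stub_dressedDefectDecay : DressedDefectDecay := by
  sorry

/-- stub 7/7 — the slaving induction (discrete maximum principle on depth). See `DefectSlaving`. -/
theorem stub_defectSlaving : DefectSlaving := by
  sorry

/-! ## §4 Kernel-checked composition: the seven stubs prove the crux BY NAME -/

/-- **Composition (PROVED): the seven stub statements imply the crux statement** (verbatim, through the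
vocabulary `conjStar`/`starMass`; `crux_iff`).  `DefectSlaving` turns rows + Harnack + the three decay
inputs into `CleanDefectDecay` (`θ₁`); with `DressedDefectDecay` (`θ₂`) and the exact `TipRegrouping`
(`‖κ‖ = √3/6 ≤ 1`, `|2 sin(π/24)| ≤ 2`):
`‖T(v)‖ ≤ x_c⁻¹‖Ā_D‖ + 2‖A_D‖ ≤ (x_c⁻¹ + 2)‖A_D‖ + x_c⁻¹‖Ā_D − A_D‖ ≤ C R^{−min θᵢ} M(v)`,
`C = (x_c⁻¹ + 2)|C₁| + x_c⁻¹|C₂|`. [folklore] -/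
theorem defectDecoherence_of_parts (hTip : TipRegrouping) (hRow : SectorRowD)
    (hHar : StarMassHarnack) (hU : UnstableStarGradient) (hS : SignalStarGradient)
    (hDress : DressedDefectDecay) (hSlave : DefectSlaving) :
    ∃ C θ : ℝ, 3 / 4 < θ ∧ ∀ (Λ : Finset HexVertex), hexDomainSimplyConnected Λ →
      ∀ (u w : HexVertex), hexGraph.Adj u w → u ∉ Λ → w ∈ Λ →
        ∀ (v : HexVertex) (R : ℝ), 1 ≤ R →
          (∀ y : HexVertex, dist (hexCenter y) (hexCenter v) ≤ R → y ∈ Λ) →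
            ‖conjStar Λ s(u, w) v‖ ≤ C * R ^ (-θ) * starMass Λ s(u, w) v := by
  obtain ⟨C₁, θ₁, hθ₁, hClean⟩ := hSlave hRow hHar hU hS hDress
  obtain ⟨C₂, θ₂, hθ₂, hDirty⟩ := hDress
  have hxc : 0 < hexCriticalFugacity := hexCriticalFugacity_pos_lt_one.1
  have hxi : 0 ≤ hexCriticalFugacity⁻¹ := le_of_lt (inv_pos.mpr hxc)
  refine ⟨(hexCriticalFugacity⁻¹ + 2) * |C₁| + hexCriticalFugacity⁻¹ * |C₂|, min θ₁ θ₂,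
    lt_min hθ₁ hθ₂, ?_⟩
  intro Λ hΛ u w huw hu hw v R hR hdeep
  -- the two decay inputs at (Λ, a, v, R)
  have h1 := hClean Λ hΛ u w huw hu hw v R hR hdeep
  have h2 := hDirty Λ hΛ u w huw hu hw v R hR hdeep
  -- the exact regrouping at v (v is 1-deep since 1 ≤ R)
  have hdeep1 : ∀ y : HexVertex, dist (hexCenter y) (hexCenter v) ≤ 1 → y ∈ Λ :=
    fun y hy => hdeep y (hy.trans hR)
  obtain ⟨hT, -⟩ := hTip Λ u w huw hu hw v hdeep1
  -- abbreviations
  set A := arrivalSum Λ s(u, w) (rootAngle u w) (13 / 8) v with hAdef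
  set Ab := viaSum Λ s(u, w) (rootAngle u w) (13 / 8) v with hAbdef
  set M := starMass Λ s(u, w) v with hMdef
  -- positivity and exponent bookkeeping
  have hM0 : 0 ≤ M := Finset.sum_nonneg fun _ _ => norm_nonneg _
  have hR0 : 0 ≤ R := le_trans zero_le_one hR
  have hmono₁ : R ^ (-θ₁) ≤ R ^ (-min θ₁ θ₂) :=
    Real.rpow_le_rpow_of_exponent_le hR (neg_le_neg (min_le_left θ₁ θ₂))
  have hmono₂ : R ^ (-θ₂) ≤ R ^ (-min θ₁ θ₂) :=
    Real.rpow_le_rpow_of_exponent_le hR (neg_le_neg (min_le_right θ₁ θ₂))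
  have e1 : ‖A‖ ≤ |C₁| * (R ^ (-min θ₁ θ₂) * M) := by
    calc ‖A‖ ≤ C₁ * R ^ (-θ₁) * M := h1
      _ ≤ |C₁| * R ^ (-θ₁) * M :=
          mul_le_mul_of_nonneg_right
            (mul_le_mul_of_nonneg_right (le_abs_self _) (Real.rpow_nonneg hR0 _)) hM0
      _ ≤ |C₁| * R ^ (-min θ₁ θ₂) * M :=
          mul_le_mul_of_nonneg_right (mul_le_mul_of_nonneg_left hmono₁ (abs_nonneg _)) hM0
      _ = |C₁| * (R ^ (-min θ₁ θ₂) * M) := by ring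
  have e2 : ‖Ab - A‖ ≤ |C₂| * (R ^ (-min θ₁ θ₂) * M) := by
    calc ‖Ab - A‖ ≤ C₂ * R ^ (-θ₂) * M := h2
      _ ≤ |C₂| * R ^ (-θ₂) * M :=
          mul_le_mul_of_nonneg_right
            (mul_le_mul_of_nonneg_right (le_abs_self _) (Real.rpow_nonneg hR0 _)) hM0
      _ ≤ |C₂| * R ^ (-min θ₁ θ₂) * M :=
          mul_le_mul_of_nonneg_right (mul_le_mul_of_nonneg_left hmono₂ (abs_nonneg _)) hM0
      _ = |C₂| * (R ^ (-min θ₁ θ₂) * M) := by ring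
  -- the regrouping identity, in norm
  have hκ : ‖tipPhase u w‖ ≤ 1 := by
    unfold tipPhase
    rw [norm_mul, Complex.norm_exp_ofReal_mul_I, mul_one, Complex.norm_real, Real.norm_eq_abs,
      abs_neg, abs_of_nonneg (show (0 : ℝ) ≤ Real.sqrt 3 / 6 by positivity)]
    have h3 : Real.sqrt 3 ≤ 6 := by
      nlinarith [Real.sq_sqrt (show (0 : ℝ) ≤ 3 by norm_num), Real.sqrt_nonneg 3]
    linarith
  have hsin : |2 * Real.sin (Real.pi / 24)| ≤ 2 := by
    rw [abs_le]
    constructor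
    · nlinarith [Real.neg_one_le_sin (Real.pi / 24)]
    · nlinarith [Real.sin_le_one (Real.pi / 24)]
  have hX :
      ‖((hexCriticalFugacity⁻¹ : ℝ) : ℂ) * Ab + ((2 * Real.sin (Real.pi / 24) : ℝ) : ℂ) * A‖ ≤
        hexCriticalFugacity⁻¹ * ‖Ab‖ + 2 * ‖A‖ := by
    refine (norm_add_le _ _).trans ?_
    rw [norm_mul, norm_mul, Complex.norm_real, Complex.norm_real, Real.norm_eq_abs,
      Real.norm_eq_abs, abs_of_nonneg hxi]
    have : |2 * Real.sin (Real.pi / 24)| * ‖A‖ ≤ 2 * ‖A‖ :=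
      mul_le_mul_of_nonneg_right hsin (norm_nonneg _)
    linarith
  have hT' : ‖conjStar Λ s(u, w) v‖ ≤ hexCriticalFugacity⁻¹ * ‖Ab‖ + 2 * ‖A‖ := by
    rw [hT, norm_mul]
    have hk := mul_le_mul_of_nonneg_right hκ
      (norm_nonneg (((hexCriticalFugacity⁻¹ : ℝ) : ℂ) * Ab +
        ((2 * Real.sin (Real.pi / 24) : ℝ) : ℂ) * A))
    linarith
  -- triangle inequality Ā = A + (Ā − A)
  have hAb' : ‖Ab‖ ≤ ‖A‖ + ‖Ab - A‖ := by
    calc ‖Ab‖ = ‖A + (Ab - A)‖ := by congr 1; ring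
      _ ≤ ‖A‖ + ‖Ab - A‖ := norm_add_le _ _
  -- assemble
  have e3 : hexCriticalFugacity⁻¹ * ‖Ab‖ ≤ hexCriticalFugacity⁻¹ * (‖A‖ + ‖Ab - A‖) :=
    mul_le_mul_of_nonneg_left hAb' hxi
  have e4 := mul_le_mul_of_nonneg_left e1 hxi
  have e5 := mul_le_mul_of_nonneg_left e2 hxi
  calc ‖conjStar Λ s(u, w) v‖ ≤ hexCriticalFugacity⁻¹ * ‖Ab‖ + 2 * ‖A‖ := hT'
    _ ≤ hexCriticalFugacity⁻¹ * (‖A‖ + ‖Ab - A‖) + 2 * ‖A‖ := by linarith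
    _ ≤ hexCriticalFugacity⁻¹ * (|C₁| * (R ^ (-min θ₁ θ₂) * M) + |C₂| * (R ^ (-min θ₁ θ₂) * M)) +
          2 * (|C₁| * (R ^ (-min θ₁ θ₂) * M)) := by
        linarith
    _ = ((hexCriticalFugacity⁻¹ + 2) * |C₁| + hexCriticalFugacity⁻¹ * |C₂|) * R ^ (-min θ₁ θ₂) * M := by
        ring

/-- **The line closes the crux BY NAME**: the composition `defectDecoherence_of_parts` fed with the
seven registered stubs (the only theorem of this file whose conclusion is the route decl; no hypotheses,
so the audit sees the crux inhabited modulo the seven stub placeholders and nothing else). -/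
theorem DefectDecoherence_of : DefectDecoherence :=
  defectDecoherence_of_parts stub_tipRegrouping stub_sectorRowD stub_starMassHarnack
    stub_unstableStarGradient stub_signalStarGradient stub_dressedDefectDecay stub_defectSlaving

end Summit.CriticalPhenomena.SAWScalingLimit.Cruxes.DefectDecoherence.SectorSlaving

end
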